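import Literature.Geometry.Kaehler.PoincareLemmaFlat
import HarnessLib

/-!
# The homotopy operator of a translation

Companion of `Literature/Geometry/Kaehler/PoincareLemmaFlat.lean` (the *radial* homotopy
operator). For Mathlib's exterior derivative `extDeriv` of forms `ω : E → E [⋀^Fin (k+1)]→L[ℝ] F`
on a finite-dimensional real normed space `E` and a vector `a ∈ E` we construct the
**straight-line homotopy operator** of the translation `τ_a : x ↦ x + a`,
`transOperator a ω x = ∫₀¹ ι_a ω (x + t a) dt` (a `k`-form; `ι_a` = insertion of `a` in the
first slot), prove that it preserves smoothness — jointly in `(a, x)`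
(`contDiff_transOperator_uncurry`) — and periodicity (`transOperator_add_period`), and the
**homotopy formula** `d (P_a ω) + P_a (dω) = τ_a^* ω - ω` for smooth `ω`
(`extDeriv_transOperator_add`: `d (P_a ω) x + P_a (dω) x = ω (x + a) - ω x`). In particular
a closed form and its translate differ by the exact form `d (P_a ω)`
(`sub_eq_extDeriv_transOperator`). This is Cartan's formula `L_a = d ι_a + ι_a d` for the
constant vector field `a`, integrated along its flow (Bott–Tu (1982), §I.4, the homotopy
operator of a homotopy; Warner (1983), 4.18; Lee (2013), Prop. 14.35 / Thm. 17.14); used for the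
de Rham cohomology of tori (averaging over translations).

## References

* R. Bott, L. W. Tu, *Differential Forms in Algebraic Topology* (1982), §I.4. [BottTu1982Forms]
* F. W. Warner, *Foundations of Differentiable Manifolds and Lie Groups* (1983), 4.18.
-/

noncomputable section

open scoped Topology ContDiff
open Set Filter MeasureTheory intervalIntegral ContinuousAlternatingMap

namespace Literature.Geometry.Kaehler

variable {E : Type*} [NormedAddCommGroup E] [NormedSpace ℝ E]
  {F : Type*} [NormedAddCommGroup F] [NormedSpace ℝ F] {k : ℕ}

section Translation

variable (a : E)

/-- The integrand of the homotopy operator of the translation by `a`: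
`(t, x) ↦ ι_a ω (x + t a)`, a `k`-form for a `(k+1)`-form `ω`. Bott–Tu (1982), §I.4.
[cite: BottTu1982Forms, §I.4] -/
def transIntegrand (β : E → E [⋀^Fin (k + 1)]→L[ℝ] F) (p : ℝ × E) : E [⋀^Fin k]→L[ℝ] F :=
  (β (p.2 + p.1 • a)).curryLeft a

/-- **The homotopy operator of the translation by `a`**: `P_a ω x = ∫₀¹ ι_a ω (x + t a) dt`,
a `k`-form for a `(k+1)`-form `ω`. Bott–Tu (1982), §I.4 (homotopy operator of the straight-line
homotopy from `id` to `τ_a`); Warner (1983), 4.18. [cite: BottTu1982Forms, §I.4] -/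
def transOperator (β : E → E [⋀^Fin (k + 1)]→L[ℝ] F) (x : E) : E [⋀^Fin k]→L[ℝ] F :=
  ∫ t in (0 : ℝ)..1, transIntegrand a β (t, x)

/-- The integrand at time `t` is continuous in `t` for continuous `ω`. [folklore] -/
theorem continuous_transIntegrand_left {β : E → E [⋀^Fin (k + 1)]→L[ℝ] F} (hβ : Continuous β)
    (x : E) : Continuous fun t : ℝ ↦ transIntegrand a β (t, x) := by
  simp only [transIntegrand]
  exact isBoundedBilinearMap_curryLeft.continuous.comp
    ((hβ.comp (continuous_const.add (continuous_id.smul continuous_const))).prodMk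
      continuous_const)

/-- `P_a` is linear: additivity. [folklore] -/
theorem transOperator_add {β β' : E → E [⋀^Fin (k + 1)]→L[ℝ] F} (hβ : Continuous β)
    (hβ' : Continuous β') :
    transOperator a (β + β') = transOperator a β + transOperator a β' := by
  funext x
  simp only [Pi.add_apply, transOperator]
  rw [← intervalIntegral.integral_add
    ((continuous_transIntegrand_left a hβ x).intervalIntegrable _ _)
    ((continuous_transIntegrand_left a hβ' x).intervalIntegrable _ _)]
  refine intervalIntegral.integral_congr fun t _ ↦ ?_
  simp [transIntegrand]

/-- `P_a` is linear: homogeneity. [folklore] -/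
theorem transOperator_smul (c : ℝ) (β : E → E [⋀^Fin (k + 1)]→L[ℝ] F) :
    transOperator a (c • β) = c • transOperator a β := by
  funext x
  simp only [transOperator, Pi.smul_apply]
  rw [← intervalIntegral.integral_smul]
  refine intervalIntegral.integral_congr fun t _ ↦ ?_
  simp [transIntegrand]

/-- **`P_a` preserves periods**: if `ω (y + λ) = ω y` for all `y` then
`P_a ω (x + λ) = P_a ω x`. [folklore] -/
theorem transOperator_add_period {β : E → E [⋀^Fin (k + 1)]→L[ℝ] F} {l : E}
    (h : ∀ y, β (y + l) = β y) (x : E) : transOperator a β (x + l) = transOperator a β x := by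
  refine intervalIntegral.integral_congr fun t _ ↦ ?_
  simp only [transIntegrand, add_right_comm x l, h]

/-- The integrand is jointly `C^∞` in `(t, a, x)` for `C^∞` forms. [folklore] -/
theorem contDiff_transIntegrand_uncurry {β : E → E [⋀^Fin (k + 1)]→L[ℝ] F} (hβ : ContDiff ℝ ∞ β) :
    ContDiff ℝ ∞ fun p : ℝ × (E × E) ↦ transIntegrand p.2.1 β (p.1, p.2.2) := by
  have hγ : ContDiff ℝ ∞ fun p : ℝ × (E × E) ↦ p.2.2 + p.1 • p.2.1 :=
    (contDiff_snd.comp contDiff_snd).add (contDiff_fst.smul (contDiff_fst.comp contDiff_snd))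
  exact isBoundedBilinearMap_curryLeft.contDiff.comp
    ((hβ.comp hγ).prodMk (contDiff_fst.comp contDiff_snd))

/-- The integrand is jointly `C^∞` in `(t, x)` for `C^∞` forms. [folklore] -/
theorem contDiff_transIntegrand {β : E → E [⋀^Fin (k + 1)]→L[ℝ] F} (hβ : ContDiff ℝ ∞ β) :
    ContDiff ℝ ∞ (transIntegrand a β) := by
  have hγ : ContDiff ℝ ∞ fun p : ℝ × E ↦ p.2 + p.1 • a :=
    contDiff_snd.add (contDiff_fst.smul contDiff_const)
  exact isBoundedBilinearMap_curryLeft.contDiff.comp ((hβ.comp hγ).prodMk contDiff_const)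

/-- **The partial derivative in `x` of the integrand** at `(t, x)` applied to `h`:
`ι_a (Dω(x + t a) h)` (chain rule; `ι_a` is linear). [folklore] -/
theorem fderiv_transIntegrand_apply {β : E → E [⋀^Fin (k + 1)]→L[ℝ] F} (hβ : ContDiff ℝ ∞ β)
    (t : ℝ) (x h : E) :
    fderiv ℝ (fun y ↦ transIntegrand a β (t, y)) x h = (fderiv ℝ β (x + t • a) h).curryLeft a := by
  have hγ' : HasFDerivAt (fun y : E ↦ y + t • a) (ContinuousLinearMap.id ℝ E) x :=
    (hasFDerivAt_id x).add_const (t • a)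
  have hβγ : HasFDerivAt (fun y : E ↦ β (y + t • a))
      ((fderiv ℝ β (x + t • a)).comp (ContinuousLinearMap.id ℝ E)) x :=
    ((hβ.differentiable (by simp)) _).hasFDerivAt.comp x hγ'
  have hb := (isBoundedBilinearMap_curryLeft (E := E) (F := F) (k := k)).hasFDerivAt (β (x + t • a), a)
  have hB := hb.comp x (hβγ.prodMk (hasFDerivAt_const a x))
  have hH : HasFDerivAt (fun y ↦ transIntegrand a β (t, y)) _ x := hB
  rw [hH.fderiv]
  simp [IsBoundedBilinearMap.deriv_apply]

variable [FiniteDimensional ℝ E]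

/-- **The homotopy operator preserves smoothness**, jointly in the translation vector:
`(a, x) ↦ P_a ω x` is `C^∞` if `ω` is (differentiation under the integral sign,
`Literature.Analysis.FunctionSpaces.contDiff_parametric_intervalIntegral`). [folklore] -/
theorem contDiff_transOperator_uncurry {β : E → E [⋀^Fin (k + 1)]→L[ℝ] F} (hβ : ContDiff ℝ ∞ β) :
    ContDiff ℝ ∞ fun q : E × E ↦ transOperator q.1 β q.2 := by
  have h := Literature.Analysis.FunctionSpaces.contDiff_parametric_intervalIntegral (P := E × E)
    (contDiff_transIntegrand_uncurry hβ) 0 1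
  simp only [transOperator]
  exact h

/-- `P_a ω` is `C^∞` if `ω` is. [folklore] -/
theorem contDiff_transOperator {β : E → E [⋀^Fin (k + 1)]→L[ℝ] F} (hβ : ContDiff ℝ ∞ β) :
    ContDiff ℝ ∞ (transOperator a β) :=
  Literature.Analysis.FunctionSpaces.contDiff_parametric_intervalIntegral
    (contDiff_transIntegrand a hβ) 0 1

/-- **The homotopy formula** `d (P_a ω) x + P_a (dω) x = ω (x + a) - ω x` for a `C^∞` form `ω` of
positive degree on a finite-dimensional space (`F` complete): Cartan's formula for the constant
vector field `a` integrated along its flow. Proof: differentiate under the integral sign, use the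
algebraic identity `alternatizeUncurryFin_add_curryLeft` pointwise in `t`
(`Alt (ι_a Dω h) + ι_a (Alt Dω) = Dω a`), and integrate `d/dt ω(x + t a)` by the fundamental
theorem of calculus. Bott–Tu (1982), §I.4; Warner (1983), 4.18. [cite: BottTu1982Forms, §I.4] -/
theorem extDeriv_transOperator_add [CompleteSpace F] {β : E → E [⋀^Fin (k + 1)]→L[ℝ] F}
    (hβ : ContDiff ℝ ∞ β) (x : E) :
    extDeriv (transOperator a β) x + transOperator a (extDeriv β) x = β (x + a) - β x := by
  have hinf : (∞ : WithTop ℕ∞) ≠ 0 := by simp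
  have hH : ContDiff ℝ ∞ (transIntegrand a β) := contDiff_transIntegrand a hβ
  -- the partial derivative in `x` of the integrand, at `(σ, x)`
  set D : ℝ → E →L[ℝ] E [⋀^Fin k]→L[ℝ] F :=
    fun σ ↦ fderiv ℝ (fun y ↦ transIntegrand a β (σ, y)) x with hD
  have hDapply : ∀ σ h, D σ h = (fderiv ℝ β (x + σ • a) h).curryLeft a := fun σ h ↦
    fderiv_transIntegrand_apply a hβ σ x h
  have hDH : ∀ σ h, fderiv ℝ (transIntegrand a β) (σ, x) ((0 : ℝ), h) = D σ h := by
    intro σ h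
    have h1 := (Literature.Analysis.FunctionSpaces.hasFDerivAt_comp_prodMk hH hinf σ x).fderiv
    rw [hD]
    dsimp only
    rw [h1]
    rfl
  -- the derivative of `P_a β` in the direction `h`, under the integral sign
  have hKd : ∀ h, fderiv ℝ (transOperator a β) x h = ∫ σ in (0 : ℝ)..1, D σ h := by
    intro h
    have h1 := Literature.Analysis.FunctionSpaces.fderiv_parametric_intervalIntegral_apply hH hinf
      0 1 x h
    simp only [hDH] at h1
    exact h1
  have hDc : ∀ h, Continuous fun σ ↦ D σ h := by
    intro h
    have h1 : Continuous fun σ : ℝ ↦ fderiv ℝ (transIntegrand a β) (σ, x) ((0 : ℝ), h) :=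
      ((hH.continuous_fderiv hinf).comp (continuous_id.prodMk continuous_const)).clm_apply
        continuous_const
    simp only [hDH] at h1
    exact h1
  -- the second summand and the primitive in `t`
  set dβ : E → E [⋀^Fin (k + 1 + 1)]→L[ℝ] F := extDeriv β with hdβ
  have hdβs : ContDiff ℝ ∞ dβ := by
    rw [hdβ]
    exact (alternatizeUncurryFinCLM ℝ E F).contDiff.comp (hβ.fderiv_right (m := ∞) (by simp))
  set φ : ℝ → E [⋀^Fin (k + 1)]→L[ℝ] F := fun σ ↦ β (x + σ • a) with hφ
  set φ' : ℝ → E [⋀^Fin (k + 1)]→L[ℝ] F := fun σ ↦ fderiv ℝ β (x + σ • a) a with hφ'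
  have hφderiv : ∀ σ, HasDerivAt φ (φ' σ) σ := by
    intro σ
    have hγ : HasDerivAt (fun σ : ℝ ↦ x + σ • a) a σ := by
      simpa using ((hasDerivAt_id σ).smul_const a).const_add x
    exact ((hβ.differentiable hinf) _).hasFDerivAt.comp_hasDerivAt σ hγ
  have hφ'c : Continuous φ' := by
    have h1 : Continuous fun σ : ℝ ↦ x + σ • a :=
      continuous_const.add (continuous_id.smul continuous_const)
    exact ((hβ.continuous_fderiv hinf).comp h1).clm_apply continuous_const
  -- pointwise identity of the integrands
  have hpt : ∀ σ, alternatizeUncurryFin (D σ) + transIntegrand a dβ (σ, x) = φ' σ := by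
    intro σ
    have key := alternatizeUncurryFin_add_curryLeft (f := fderiv ℝ β (x + σ • a)) (P := D σ)
      (w := a) (hDapply σ)
    simpa only [transIntegrand, hdβ, extDeriv, hφ'] using key
  -- assemble, after evaluating at a tuple of vectors `v`
  ext v
  have hi2 : IntervalIntegrable (fun σ : ℝ ↦ transIntegrand a dβ (σ, x)) volume 0 1 :=
    (continuous_transIntegrand_left a hdβs.continuous x).intervalIntegrable 0 1
  have hi3 : IntervalIntegrable φ' volume 0 1 := hφ'c.intervalIntegrable 0 1
  have hci : ∀ i : Fin (k + 1), Continuous fun σ : ℝ ↦ D σ (v i) (i.removeNth v) := fun i ↦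
    (ContinuousAlternatingMap.apply ℝ E F (i.removeNth v)).continuous.comp (hDc (v i))
  have hL1 : extDeriv (transOperator a β) x v =
      ∫ σ in (0 : ℝ)..1, ∑ i : Fin (k + 1), ((-1 : ℝ) ^ (i : ℕ)) • D σ (v i) (i.removeNth v) := by
    rw [intervalIntegral.integral_finsetSum]
    · simp only [extDeriv, alternatizeUncurryFin_apply, ← Int.cast_smul_eq_zsmul ℝ, Int.cast_pow,
        Int.cast_neg, Int.cast_one, hKd]
      refine Finset.sum_congr rfl fun i _ ↦ ?_
      rw [intervalIntegral_apply_alternating ((hDc (v i)).intervalIntegrable 0 1),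
        intervalIntegral.integral_smul]
    · intro i _
      exact ((hci i).const_smul _).intervalIntegrable 0 1
  have hL1' : ∀ σ, ∑ i : Fin (k + 1), ((-1 : ℝ) ^ (i : ℕ)) • D σ (v i) (i.removeNth v) =
      alternatizeUncurryFin (D σ) v := fun σ ↦ by
    simp only [alternatizeUncurryFin_apply, ← Int.cast_smul_eq_zsmul ℝ, Int.cast_pow,
      Int.cast_neg, Int.cast_one]
  have hi1 : IntervalIntegrable (fun σ : ℝ ↦ alternatizeUncurryFin (D σ) v) volume 0 1 := by
    have hc : Continuous fun σ : ℝ ↦ ∑ i : Fin (k + 1), ((-1 : ℝ) ^ (i : ℕ)) • D σ (v i) (i.removeNth v) :=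
      continuous_finsetSum _ fun i _ ↦ (hci i).const_smul _
    simp only [hL1'] at hc
    exact hc.intervalIntegrable 0 1
  have hi2v : IntervalIntegrable (fun σ : ℝ ↦ transIntegrand a dβ (σ, x) v) volume 0 1 :=
    ((ContinuousAlternatingMap.apply ℝ E F v).continuous.comp
      (continuous_transIntegrand_left a hdβs.continuous x)).intervalIntegrable 0 1
  rw [ContinuousAlternatingMap.sub_apply, ContinuousAlternatingMap.add_apply, hL1, transOperator,
    intervalIntegral_apply_alternating hi2]
  simp only [hL1']
  rw [← intervalIntegral.integral_add hi1 hi2v]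
  have hsum : ∀ σ, alternatizeUncurryFin (D σ) v + transIntegrand a dβ (σ, x) v = φ' σ v :=
    fun σ ↦ by rw [← ContinuousAlternatingMap.add_apply, hpt]
  simp only [hsum]
  rw [← intervalIntegral_apply_alternating hi3,
    intervalIntegral.integral_eq_sub_of_hasDerivAt (fun σ _ ↦ hφderiv σ) hi3]
  simp [hφ]

/-- **A closed form and its translate differ by an exact form**:
`ω (x + a) - ω x = d (P_a ω) x` for a closed `C^∞` form `ω` (`dω = 0`). Bott–Tu (1982), §I.4,
Cor. 4.1.2 (homotopic maps induce the same map in cohomology), for `τ_a ≃ id`.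
[cite: BottTu1982Forms, §I.4] -/
theorem sub_eq_extDeriv_transOperator [CompleteSpace F] {β : E → E [⋀^Fin (k + 1)]→L[ℝ] F}
    (hβ : ContDiff ℝ ∞ β) (hcl : extDeriv β = 0) (x : E) :
    β (x + a) - β x = extDeriv (transOperator a β) x := by
  have h := extDeriv_transOperator_add a hβ x
  have h0 : transOperator a (extDeriv β) x = 0 := by
    rw [hcl]
    simp [transOperator, transIntegrand]
  rw [h0, add_zero] at h
  exact h.symm

end Translation

/-- `P_a 0 = 0`. [folklore] -/
@[simp]
theorem transOperator_zero (a : E) : transOperator a (0 : E → E [⋀^Fin (k + 1)]→L[ℝ] F) = 0 := by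
  funext x
  simp [transOperator, transIntegrand]

end Literature.Geometry.Kaehler
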